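import Literature.MathematicalPhysics.StatisticalMechanics.MuGroundStateConfiguration
import Summits.AtomisticToContinuum.Crystallization.Theorems.ChargedEnergyGap.Negative.Unconditional

/-!
# FrustratedLawDichotomy · crux `AperiodicFrustratedLawGap` (stmt-AtomisticToContinuum-27623) — CLUSTER EXACTNESS OF `e⋆`-μ-EQUILIBRIA
# (configuration level, surgery currency; decomp-a2c, prover hand 2, structural share, generation 6)

The law-free open core of item 27623 (`R_GSC^aper`, `FrustratedLawDichotomyAperiodicGapGSCDoor`; `= GCNS G ∧ C ∧ N`,
`FrustratedLawDichotomyGSCDoorDictionary`) hands the closer ONE configuration `X ⊆ ℝ³`: rooted, `7/10`-separated, textured, not a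
periodic translate, and an `e⋆`-μ-ground-state configuration of Lennard-Jones (`IsMuGSC lennardJones e⋆ X`, Sütő's second form).  This
module derives, from the most general landed necessary condition of the surgery currency — the `k`-atom removal floor
`U(C) + I(C, X∖C) ≤ μ·|C|` (`FrustratedLawDichotomyGSCSurgeryTests.removal_le_of_isMuGSC`, here re-derived from `IsMuGSC.le` in the
rearranged form `interactionEnergy_le_of_isMuGSC` so that this module imports NO route file of the lineage) — combined with the tree's
periodisation bound `ChargedEnergyGapNegative.card_mul_eStar_le` (`|C|·e⋆ ≤ U(C)` for every finite configuration of distinct points,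
unconditional since item 0714), the TWO-SIDED EXACTNESS of every finite cluster `C = xf(Fin n) ⊆ X` of such an `X`:

* `cross_le_of_isMuGSC`        : for a `μ`GSC of `V_LJ` at ANY `μ`:  `I(C, X∖C) ≤ (μ − e⋆)·n`;
* `cross_nonpos_of_isMuGSC`    : at `μ = e⋆`:  `I(C, X∖C) ≤ 0` — EVERY finite cluster attracts the rest on balance;
* `interactionEnergy_sandwich` : `n·e⋆ ≤ U(C) ≤ n·e⋆ − I(C, X∖C)` — the internal energy of every finite cluster is `e⋆` per atom up to
  (minus) its cross-interaction with the rest; with the tree's `ChargedEnergyGapNegative.excess_nonneg` and `excess_le_neg_cross`: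
  `0 ≤ U(C) − n·e⋆ ≤ −I(C, X∖C)`;
* `sum_siteEnergy_eq`          : the double-counting identity `Σ_{p ∈ C} h_p(X) = 2·U(C) + I(C, X∖C)` for the one-particle energies
  `h_p(X) = Σ'_{q ∈ X∖{p}} V(dist p q)` (any potential with summable fields and `V 0 = 0`; `tsum_diff_singleton_eq_tsum`);
* `half_sum_siteEnergy_sandwich` : `n·e⋆ + ½·I ≤ ½·Σ_{p∈C} h_p ≤ n·e⋆ − ½·I`, i.e. `|½·Σ_{p ∈ C} h_p − n·e⋆| ≤ ½·|I(C, X∖C)|`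
  (`abs_half_sum_siteEnergy_sub_le`);
* `tendsto_energyPerAtom` / `tendsto_siteEnergyPerAtom` : along ANY family of clusters whose cross-interaction per atom tends to `0`
  (van Hove clusters), the energy per atom `U(C)/n` and the mean half site energy `Σ h_p/(2n)` tend to `e⋆` — the ENERGY DENSITY of an exact
  μ-equilibrium is pinned to `e⋆` (configuration level, no law, no ergodic theorem).

Reading for the crux: the hypothetical textured aperiodic `e⋆`-μGSC of the residual has energy density EXACTLY `e⋆` on every van Hove
sequence of clusters and every one of its finite clusters is bound to the rest (`I ≤ 0`) with internal excess at most that binding.  With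
a certified witness `e(Q) ≤ e_up` (today `e_up = −1/24` in this import closure; the certified `−0.7175` of
`ThreeConeCertificateOnePercentCertificateFccWindow` / the Literature hcp certificate wait for a farm build) the upper halves are numeric:
`U(C) + I ≤ e_up·n` (`FrustratedLawDichotomyGSCSurgeryTests.not_isMuGSC_eStar_of_underboundCluster`).  The NEW information of this module is
the LOWER half (periodisation) and hence the sign of `I` and the two-sided pinning.  All statements `[folklore]` given Sütő's definition
[cite: Suto2006, §2 Definition (μGSC, second form)] and the periodisation bound.
-/

noncomputable section

namespace Summit.AtomisticToContinuum.Crystallization.Theorems.FrustratedLawDichotomyGSCClusterExactness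

open Filter Topology
open Literature.MathematicalPhysics.StatisticalMechanics
open Summit.AtomisticToContinuum.Crystallization.Theorems.ChargedEnergyGapNegative (E3 eStar eStar_le card_mul_eStar_le excess_nonneg)

/-! ## §1. Bookkeeping: sub-sums of summable fields, and the double-counting identity (any dimension, any potential) -/

section General

variable {d : ℕ} {V : ℝ → ℝ} {μ : ℝ} {X : Set (EuclideanSpace ℝ (Fin d))}

/-- A field summable over `X` is summable over every `Y ⊆ X`. [folklore] -/
theorem summable_of_subset {f : EuclideanSpace ℝ (Fin d) → ℝ} {Y : Set (EuclideanSpace ℝ (Fin d))}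
    (h : Summable (f ∘ (↑) : ↥X → ℝ)) (hYX : Y ⊆ X) : Summable (f ∘ (↑) : ↥Y → ℝ) := by
  have h' := h.comp_injective (Set.inclusion_injective hYX)
  refine h'.congr fun y => ?_
  rfl

/-- The range of a finite configuration is the coercion of the image finset. [folklore] -/
theorem range_eq_coe_image {n : ℕ} (xf : Fin n → EuclideanSpace ℝ (Fin d)) :
    Set.range xf = ↑(Finset.univ.image xf) := by
  rw [Finset.coe_image, Finset.coe_univ, Set.image_univ]

/-- The field of `r` summed over the (finite) range of an injective `xf` is the finite sum `Σ_k V(dist r (xf k))`. [folklore] -/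
theorem tsum_range_eq_sum {n : ℕ} {xf : Fin n → EuclideanSpace ℝ (Fin d)} (hxf : Function.Injective xf)
    (r : EuclideanSpace ℝ (Fin d)) :
    ∑' y : ↥(Set.range xf), V (dist r y) = ∑ k, V (dist r (xf k)) :=
  calc ∑' y : ↥(Set.range xf), V (dist r y)
        = ∑' y : ↥(↑(Finset.univ.image xf) : Set (EuclideanSpace ℝ (Fin d))), V (dist r y) :=
          tsum_congr_set_coe (fun y => V (dist r y)) (range_eq_coe_image xf)
    _ = ∑ y ∈ Finset.univ.image xf, V (dist r y) := Finset.tsum_subtype' _ (fun y => V (dist r y))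
    _ = ∑ k, V (dist r (xf k)) := Finset.sum_image fun _ _ _ _ hab => hxf hab

/-- **Splitting a field over `X` at a finite cluster**: for `xf ⊆ X` injective and a field summable over `X`,
`Σ'_{y ∈ X} V(dist r y) = Σ_k V(dist r (xf k)) + Σ'_{y ∈ X ∖ xf} V(dist r y)`. [folklore] -/
theorem tsum_eq_sum_add_tsum_diff (hsum : ∀ r : EuclideanSpace ℝ (Fin d), Summable fun y : ↥X => V (dist r y))
    {n : ℕ} {xf : Fin n → EuclideanSpace ℝ (Fin d)} (hxf : Function.Injective xf) (hX : Set.range xf ⊆ X)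
    (r : EuclideanSpace ℝ (Fin d)) :
    ∑' y : ↥X, V (dist r y) = (∑ k, V (dist r (xf k))) + ∑' y : ↥(X \ Set.range xf), V (dist r y) := by
  set f : EuclideanSpace ℝ (Fin d) → ℝ := fun y => V (dist r y) with hf
  have hfX : Summable (f ∘ (↑) : ↥X → ℝ) := hsum r
  have hdisj : Disjoint (Set.range xf) (X \ Set.range xf) := Set.disjoint_sdiff_right
  have hs : Summable (f ∘ (↑) : ↥(Set.range xf) → ℝ) := summable_of_subset hfX hX
  have ht : Summable (f ∘ (↑) : ↥(X \ Set.range xf) → ℝ) := summable_of_subset hfX Set.sdiff_subset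
  have hunion : X = Set.range xf ∪ (X \ Set.range xf) := (Set.union_sdiff_cancel hX).symm
  have key : ∑' y : ↥(Set.range xf ∪ (X \ Set.range xf)), f y =
      (∑' y : ↥(Set.range xf), f y) + ∑' y : ↥(X \ Set.range xf), f y :=
    hs.tsum_union_disjoint hdisj ht
  have hrange : ∑' y : ↥(Set.range xf), f y = ∑ k, V (dist r (xf k)) := tsum_range_eq_sum hxf r
  calc ∑' y : ↥X, f y = ∑' y : ↥(Set.range xf ∪ (X \ Set.range xf)), f y := tsum_congr_set_coe f hunion
    _ = (∑ k, V (dist r (xf k))) + ∑' y : ↥(X \ Set.range xf), f y := by rw [key, hrange]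

/-- **Removing the (vanishing) self term**: for a potential with `V 0 = 0` (Lennard-Jones with Lean's `0⁻¹ = 0`), the one-particle energy
`Σ'_{q ∈ X∖{p}} V(dist p q)` equals the full field `Σ'_{q ∈ X} V(dist p q)`. [folklore] -/
theorem tsum_diff_singleton_eq_tsum (hV : V 0 = 0) (p : EuclideanSpace ℝ (Fin d)) :
    ∑' q : ↥(X \ {p}), V (dist p q) = ∑' q : ↥X, V (dist p q) := by
  rw [tsum_subtype (X \ {p}) (fun q => V (dist p q)), tsum_subtype X (fun q => V (dist p q))]
  refine tsum_congr fun q => ?_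
  by_cases hq : q = p
  · subst hq
    simp only [Set.indicator, Set.mem_sdiff, Set.mem_singleton_iff, not_true_eq_false, and_false,
      dist_self, hV, ite_self]
  · by_cases hqX : q ∈ X
    · rw [Set.indicator_of_mem (Set.mem_sdiff_singleton.2 ⟨hqX, hq⟩), Set.indicator_of_mem hqX]
    · rw [Set.indicator_of_notMem (fun h => hqX h.1), Set.indicator_of_notMem hqX]

/-- **The double-counting identity** `Σ_{p ∈ C} h_p(X) = 2·U(C) + I(C, X∖C)` for a finite cluster `C = xf(Fin n) ⊆ X` of a configuration
with summable fields and `V 0 = 0`: the one-particle energies of the cluster atoms count every internal bond twice and every bond to the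
rest once. [folklore] -/
theorem sum_siteEnergy_eq (hV : V 0 = 0) (hsum : ∀ r : EuclideanSpace ℝ (Fin d), Summable fun y : ↥X => V (dist r y))
    {n : ℕ} {xf : Fin n → EuclideanSpace ℝ (Fin d)} (hxf : Function.Injective xf) (hX : Set.range xf ⊆ X) :
    ∑ i, ∑' q : ↥(X \ {xf i}), V (dist (xf i) q) =
      2 * interactionEnergy V xf + ∑ i, ∑' y : ↥(X \ Set.range xf), V (dist (xf i) y) := by
  rw [two_mul_interactionEnergy_eq_sum_sum V hV xf, ← Finset.sum_add_distrib]
  refine Finset.sum_congr rfl fun i _ => ?_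
  rw [tsum_diff_singleton_eq_tsum hV, tsum_eq_sum_add_tsum_diff hsum hxf hX]

/-- **Removal floor, rearranged** (any `μ`GSC; Sütő's stability clause with `k = 0`): `U(C) ≤ μ·n − I(C, X∖C)`.
[cite: Suto2006, §2 Definition (μGSC), removal] -/
theorem interactionEnergy_le_of_isMuGSC (h : IsMuGSC V μ X) {n : ℕ} {xf : Fin n → EuclideanSpace ℝ (Fin d)}
    (hxf : Function.Injective xf) (hX : Set.range xf ⊆ X) :
    interactionEnergy V xf ≤ μ * n - ∑ i, ∑' y : ↥(X \ Set.range xf), V (dist (xf i) y) := by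
  have hR : Function.Injective (fun i : Fin 0 => (i.elim0 : EuclideanSpace ℝ (Fin d))) := fun i => i.elim0
  have hdisj : Disjoint (Set.range (fun i : Fin 0 => (i.elim0 : EuclideanSpace ℝ (Fin d)))) (X \ Set.range xf) := by
    rw [Set.range_eq_empty]
    exact Set.empty_disjoint _
  have key := h.le hxf hX hR hdisj
  have h0 : interactionEnergy V (fun i : Fin 0 => (i.elim0 : EuclideanSpace ℝ (Fin d))) = 0 :=
    interactionEnergy_of_subsingleton V _
  simp only [h0, Finset.univ_eq_empty, Finset.sum_empty, Nat.cast_zero, mul_zero, zero_add, sub_zero] at key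
  linarith

/-- **Site-energy form of the removal floor** (any `μ`GSC with `V 0 = 0`): `½·Σ_{p∈C} h_p ≤ μ·n − ½·I(C, X∖C)`. [folklore] -/
theorem half_sum_siteEnergy_le_of_isMuGSC (hV : V 0 = 0) (h : IsMuGSC V μ X) {n : ℕ} {xf : Fin n → EuclideanSpace ℝ (Fin d)}
    (hxf : Function.Injective xf) (hX : Set.range xf ⊆ X) :
    (1 / 2) * ∑ i, ∑' q : ↥(X \ {xf i}), V (dist (xf i) q) ≤
      μ * n - (1 / 2) * ∑ i, ∑' y : ↥(X \ Set.range xf), V (dist (xf i) y) := by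
  rw [sum_siteEnergy_eq hV h.summable hxf hX]
  have := interactionEnergy_le_of_isMuGSC h hxf hX
  linarith

end General

/-! ## §2. Lennard-Jones in `ℝ³`: periodisation from below, removal from above -/

section LennardJones

variable {μ : ℝ} {X : Set E3}

/-- **CROSS-INTERACTION BOUND** (any `μ`): for a `μ`GSC `X` of `V_LJ` and every finite cluster `C = xf(Fin n) ⊆ X`,
`I(C, X∖C) ≤ (μ − e⋆)·n` — periodisation (`n·e⋆ ≤ U(C)`) against the removal floor (`U(C) + I ≤ μ·n`). [folklore] -/
theorem cross_le_of_isMuGSC (h : IsMuGSC lennardJones μ X) {n : ℕ} {xf : Fin n → E3}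
    (hxf : Function.Injective xf) (hX : Set.range xf ⊆ X) :
    ∑ i, ∑' y : ↥(X \ Set.range xf), lennardJones (dist (xf i) y) ≤ (μ - eStar) * n := by
  have h1 := interactionEnergy_le_of_isMuGSC h hxf hX
  have h2 := card_mul_eStar_le hxf
  nlinarith

/-- **EVERY FINITE CLUSTER OF AN `e⋆`-μGSC ATTRACTS THE REST ON BALANCE**: `I(C, X∖C) ≤ 0`. [folklore] -/
theorem cross_nonpos_of_isMuGSC (h : IsMuGSC lennardJones eStar X) {n : ℕ} {xf : Fin n → E3}
    (hxf : Function.Injective xf) (hX : Set.range xf ⊆ X) :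
    ∑ i, ∑' y : ↥(X \ Set.range xf), lennardJones (dist (xf i) y) ≤ 0 := by
  have := cross_le_of_isMuGSC h hxf hX
  simpa only [sub_self, zero_mul] using this

/-- **THE SANDWICH**: `n·e⋆ ≤ U(C) ≤ n·e⋆ − I(C, X∖C)` for every finite cluster of an `e⋆`-μGSC of `V_LJ`. [folklore] -/
theorem interactionEnergy_sandwich (h : IsMuGSC lennardJones eStar X) {n : ℕ} {xf : Fin n → E3}
    (hxf : Function.Injective xf) (hX : Set.range xf ⊆ X) :
    (n : ℝ) * eStar ≤ interactionEnergy lennardJones xf ∧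
      interactionEnergy lennardJones xf ≤ (n : ℝ) * eStar - ∑ i, ∑' y : ↥(X \ Set.range xf), lennardJones (dist (xf i) y) := by
  refine ⟨card_mul_eStar_le hxf, ?_⟩
  have := interactionEnergy_le_of_isMuGSC h hxf hX
  linarith

/-- Inside an `e⋆`-μGSC the internal excess of a finite cluster (non-negative by `ChargedEnergyGapNegative.excess_nonneg`) is at most the
binding of the cluster to the rest: `U(C) − n·e⋆ ≤ −I(C, X∖C)`. [folklore] -/
theorem excess_le_neg_cross (h : IsMuGSC lennardJones eStar X) {n : ℕ} {xf : Fin n → E3}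
    (hxf : Function.Injective xf) (hX : Set.range xf ⊆ X) :
    interactionEnergy lennardJones xf - (n : ℝ) * eStar ≤ -∑ i, ∑' y : ↥(X \ Set.range xf), lennardJones (dist (xf i) y) := by
  have := (interactionEnergy_sandwich h hxf hX).2
  linarith

/-- **Site-energy sandwich**: `n·e⋆ + ½·I ≤ ½·Σ_{p ∈ C} h_p(X) ≤ n·e⋆ − ½·I` for every finite cluster of an `e⋆`-μGSC of `V_LJ`
(`h_p(X) = Σ'_{q ∈ X∖{p}} V_LJ(dist p q)`, `I = I(C, X∖C)`). [folklore] -/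
theorem half_sum_siteEnergy_sandwich (h : IsMuGSC lennardJones eStar X) {n : ℕ} {xf : Fin n → E3}
    (hxf : Function.Injective xf) (hX : Set.range xf ⊆ X) :
    (n : ℝ) * eStar + (1 / 2) * ∑ i, ∑' y : ↥(X \ Set.range xf), lennardJones (dist (xf i) y) ≤
        (1 / 2) * ∑ i, ∑' q : ↥(X \ {xf i}), lennardJones (dist (xf i) q) ∧
      (1 / 2) * ∑ i, ∑' q : ↥(X \ {xf i}), lennardJones (dist (xf i) q) ≤
        (n : ℝ) * eStar - (1 / 2) * ∑ i, ∑' y : ↥(X \ Set.range xf), lennardJones (dist (xf i) y) := by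
  rw [sum_siteEnergy_eq lennardJones_zero h.summable hxf hX]
  obtain ⟨h1, h2⟩ := interactionEnergy_sandwich h hxf hX
  constructor <;> linarith

/-- **`|½·Σ_{p ∈ C} h_p − n·e⋆| ≤ −½·I(C, X∖C)`** (note `−I ≥ 0` by `cross_nonpos_of_isMuGSC`). [folklore] -/
theorem abs_half_sum_siteEnergy_sub_le (h : IsMuGSC lennardJones eStar X) {n : ℕ} {xf : Fin n → E3}
    (hxf : Function.Injective xf) (hX : Set.range xf ⊆ X) :
    |(1 / 2) * ∑ i, ∑' q : ↥(X \ {xf i}), lennardJones (dist (xf i) q) - (n : ℝ) * eStar| ≤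
      -((1 / 2) * ∑ i, ∑' y : ↥(X \ Set.range xf), lennardJones (dist (xf i) y)) := by
  obtain ⟨h1, h2⟩ := half_sum_siteEnergy_sandwich h hxf hX
  rw [abs_le]
  constructor <;> linarith

/-- **`|U(C) − n·e⋆| ≤ −I(C, X∖C)`**. [folklore] -/
theorem abs_interactionEnergy_sub_le (h : IsMuGSC lennardJones eStar X) {n : ℕ} {xf : Fin n → E3}
    (hxf : Function.Injective xf) (hX : Set.range xf ⊆ X) :
    |interactionEnergy lennardJones xf - (n : ℝ) * eStar| ≤ -∑ i, ∑' y : ↥(X \ Set.range xf), lennardJones (dist (xf i) y) := by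
  obtain ⟨h1, h2⟩ := interactionEnergy_sandwich h hxf hX
  rw [abs_le]
  constructor <;> linarith

end LennardJones

/-! ## §3. Energy density of an exact μ-equilibrium along van Hove clusters -/

section Density

variable {X : Set E3} {ι : Type*} {l : Filter ι}

/-- **ENERGY PER ATOM → `e⋆`**: along any family of finite clusters `C_j = xf_j(Fin n_j) ⊆ X` of an `e⋆`-μGSC of `V_LJ` whose
cross-interaction per atom `I(C_j, X∖C_j)/n_j` tends to `0` (van Hove clusters), `U(C_j)/n_j → e⋆`. [folklore] -/
theorem tendsto_energyPerAtom (h : IsMuGSC lennardJones eStar X) (n : ι → ℕ) (xf : ∀ j, Fin (n j) → E3)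
    (hxf : ∀ j, Function.Injective (xf j)) (hX : ∀ j, Set.range (xf j) ⊆ X) (hn : ∀ j, 0 < n j)
    (hI : Tendsto (fun j => (∑ i, ∑' y : ↥(X \ Set.range (xf j)), lennardJones (dist (xf j i) y)) / (n j : ℝ)) l (𝓝 0)) :
    Tendsto (fun j => interactionEnergy lennardJones (xf j) / (n j : ℝ)) l (𝓝 eStar) := by
  have hupper : Tendsto (fun j => eStar - (∑ i, ∑' y : ↥(X \ Set.range (xf j)), lennardJones (dist (xf j i) y)) / (n j : ℝ))
      l (𝓝 eStar) := by
    have := hI.const_sub eStar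
    simpa only [sub_zero] using this
  refine tendsto_of_tendsto_of_tendsto_of_le_of_le tendsto_const_nhds hupper (fun j => ?_) (fun j => ?_)
  · have hnj : (0 : ℝ) < n j := by exact_mod_cast hn j
    rw [le_div_iff₀ hnj, mul_comm]
    exact (interactionEnergy_sandwich h (hxf j) (hX j)).1
  · have hnj : (0 : ℝ) < n j := by exact_mod_cast hn j
    rw [le_sub_iff_add_le, ← add_div, div_le_iff₀ hnj]
    have := (interactionEnergy_sandwich h (hxf j) (hX j)).2
    linarith

/-- **MEAN HALF SITE ENERGY → `e⋆`**: under the same van Hove condition, `Σ_{p ∈ C_j} h_p(X) / (2 n_j) → e⋆`. [folklore] -/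
theorem tendsto_siteEnergyPerAtom (h : IsMuGSC lennardJones eStar X) (n : ι → ℕ) (xf : ∀ j, Fin (n j) → E3)
    (hxf : ∀ j, Function.Injective (xf j)) (hX : ∀ j, Set.range (xf j) ⊆ X) (hn : ∀ j, 0 < n j)
    (hI : Tendsto (fun j => (∑ i, ∑' y : ↥(X \ Set.range (xf j)), lennardJones (dist (xf j i) y)) / (n j : ℝ)) l (𝓝 0)) :
    Tendsto (fun j => ((1 / 2) * ∑ i, ∑' q : ↥(X \ {xf j i}), lennardJones (dist (xf j i) q)) / (n j : ℝ)) l (𝓝 eStar) := by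
  have hlower : Tendsto (fun j => eStar + (1 / 2) * ((∑ i, ∑' y : ↥(X \ Set.range (xf j)), lennardJones (dist (xf j i) y)) / (n j : ℝ)))
      l (𝓝 eStar) := by
    have := (hI.const_mul (1 / 2 : ℝ)).const_add eStar
    simpa only [mul_zero, add_zero] using this
  have hupper : Tendsto (fun j => eStar - (1 / 2) * ((∑ i, ∑' y : ↥(X \ Set.range (xf j)), lennardJones (dist (xf j i) y)) / (n j : ℝ)))
      l (𝓝 eStar) := by
    have := (hI.const_mul (1 / 2 : ℝ)).const_sub eStar
    simpa only [mul_zero, sub_zero] using this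
  refine tendsto_of_tendsto_of_tendsto_of_le_of_le hlower hupper (fun j => ?_) (fun j => ?_)
  · have hnj : (0 : ℝ) < n j := by exact_mod_cast hn j
    obtain ⟨h1, -⟩ := half_sum_siteEnergy_sandwich h (hxf j) (hX j)
    rw [le_div_iff₀ hnj, add_mul, mul_comm eStar, mul_assoc, div_mul_cancel₀ _ hnj.ne']
    linarith
  · have hnj : (0 : ℝ) < n j := by exact_mod_cast hn j
    obtain ⟨-, h2⟩ := half_sum_siteEnergy_sandwich h (hxf j) (hX j)
    rw [div_le_iff₀ hnj, sub_mul, mul_comm eStar, mul_assoc, div_mul_cancel₀ _ hnj.ne']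
    linarith

end Density

end Summit.AtomisticToContinuum.Crystallization.Theorems.FrustratedLawDichotomyGSCClusterExactness

end
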